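import Summits.CriticalPhenomena.PercolationContinuityZ3.Theorems.PercNearOneGluingNoHeavyLowerTailSahiCTCKleitmanDensity
import HarnessLib

/-!
# `NoHeavyLowerTail` (crux stmt-CriticalPhenomena-4575), P3 lane: the rows of the ladder inequality in Kleitman-surplus form, I —
# the squarefree row (density lemma + double counting) and the row with three doubled points (memo g25 §3 (ii), (iii))

Support file (seat `prim-l12-p3`, gen 25; `--supports stmt-CriticalPhenomena-4575`).  Pure combinatorics on top of `…SahiCTCKleitmanSurplus` /
`…SahiCTCKleitmanDensity`: for 2-live up-sets `𝒳, 𝒵`,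
* `row_sqfree` : `#W(T)·([4 ≤ t] + [5 ≤ t](t−2)) ≤ Σ_{E ∈ C(T,2)} κ(∅, T \ E)`;
* `row_three`  : `#W(D) ≤ Σ_{x ∈ D} κ({x}, (D − x) ∪ T)` for `#D = 3`;
* helpers for the based rows: `card_sub_le_sum`, `mem_cnbrs_insert`, `cnbrs_insert_erase`, `card_cedges_eq_erase_add`.
Nothing is asserted about the crux.
-/

namespace Summit.CriticalPhenomena.PercolationContinuityZ3.Theorems.SahiCTCForms

open Finset

variable {α : Type*} [DecidableEq α]
variable {𝒳 𝒵 : Finset (Finset α)}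

/-- On a 2-point free set with empty base, `κ = [the 2-set is a common member]`. [this work] -/
theorem kap_empty_pair_eq (hX2 : ∀ U ∈ 𝒳, 2 ≤ #U) (hZ2 : ∀ U ∈ 𝒵, 2 ≤ #U) {S : Finset α} (hS : #S = 2) :
    kap 𝒳 𝒵 ∅ S = if S ∈ 𝒳 ∧ S ∈ 𝒵 then 1 else 0 := by
  rw [kap_empty_eq_card_of_card_le_three hX2 hZ2 (by omega)]
  have hsub : ∀ (𝒴 : Finset (Finset α)), (∀ U ∈ 𝒴, 2 ≤ #U) → tr 𝒴 ∅ S ⊆ {S} := fun 𝒴 h2 U hU => by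
    obtain ⟨hUS, hUY⟩ := mem_tr_empty.1 hU
    rw [mem_singleton]; exact eq_of_subset_of_card_le hUS (by rw [hS]; exact h2 U hUY)
  split_ifs with h
  · have : tr 𝒳 ∅ S ∩ tr 𝒵 ∅ S = {S} := by
      refine Subset.antisymm (fun U hU => hsub 𝒳 hX2 (mem_inter.1 hU).1) (singleton_subset_iff.2 ?_)
      exact mem_inter.2 ⟨mem_tr_empty.2 ⟨Subset.rfl, h.1⟩, mem_tr_empty.2 ⟨Subset.rfl, h.2⟩⟩
    rw [this, card_singleton]; rfl
  · have : tr 𝒳 ∅ S ∩ tr 𝒵 ∅ S = ∅ := by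
      refine eq_empty_iff_forall_notMem.2 fun U hU => h ?_
      obtain ⟨hUX, hUZ⟩ := mem_inter.1 hU
      have hU : U = S := mem_singleton.1 (hsub 𝒳 hX2 hUX)
      subst hU; exact ⟨(mem_tr_empty.1 hUX).2, (mem_tr_empty.1 hUZ).2⟩
    rw [this, card_empty]; rfl

/-- Double counting: `Σ_{E ∈ C(T,2)} #W(T \ E) = C(#T − 2, 2) · #W(T)`. [this work] -/
theorem sum_card_cedges_sdiff (T : Finset α) :
    ∑ E ∈ T.powersetCard 2, #(cedges 𝒳 𝒵 (T \ E)) = (#T - 2).choose 2 * #(cedges 𝒳 𝒵 T) := by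
  have hfil : ∀ E ∈ T.powersetCard 2, cedges 𝒳 𝒵 (T \ E) = (cedges 𝒳 𝒵 T).filter fun e => e ⊆ T \ E := fun E _ => by
    ext e; simp only [mem_cedges, mem_filter]
    constructor
    · rintro ⟨h1, h2, h3, h4⟩; exact ⟨⟨h1.trans sdiff_subset, h2, h3, h4⟩, h1⟩
    · rintro ⟨⟨_, h2, h3, h4⟩, h1⟩; exact ⟨h1, h2, h3, h4⟩
  rw [sum_congr rfl fun E hE => by rw [hfil E hE]]
  have h := sum_card_bipartiteAbove_eq_sum_card_bipartiteBelow (s := T.powersetCard 2) (t := cedges 𝒳 𝒵 T)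
    (r := fun E e => e ⊆ T \ E)
  simp only [bipartiteAbove, bipartiteBelow] at h
  rw [h]
  have : ∀ e ∈ cedges 𝒳 𝒵 T, #((T.powersetCard 2).filter fun E => e ⊆ T \ E) = (#T - 2).choose 2 := fun e he => by
    obtain ⟨heT, he2, _⟩ := mem_cedges.1 he
    have : ((T.powersetCard 2).filter fun E => e ⊆ T \ E) = (T \ e).powersetCard 2 := by
      ext E; simp only [mem_filter, mem_powersetCard, subset_sdiff]
      constructor
      · rintro ⟨⟨hET, hE2⟩, _, hd⟩; exact ⟨⟨hET, hd.symm⟩, hE2⟩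
      · rintro ⟨⟨hET, hd⟩, hE2⟩; exact ⟨⟨hET, hE2⟩, heT, hd.symm⟩
    rw [this, card_powersetCard, card_sdiff_of_subset heT, he2]
  rw [sum_congr rfl this, sum_const, nsmul_eq_mul, Nat.cast_id, mul_comm]

/-- **Row (ii), the squarefree row**: for 2-live up-sets and any finset `T` (`t = #T`),
`#W(T) · ([4 ≤ t] + [5 ≤ t]·(t − 2)) ≤ Σ_{E ∈ C(T,2)} κ(∅, T \ E)` — the density lemma averaged over the 2-subsets `E`. [this work] -/
theorem row_sqfree (h𝒳 : IsUpperSet (𝒳 : Set (Finset α))) (h𝒵 : IsUpperSet (𝒵 : Set (Finset α)))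
    (hX2 : ∀ U ∈ 𝒳, 2 ≤ #U) (hZ2 : ∀ U ∈ 𝒵, 2 ≤ #U) (T : Finset α) :
    (#(cedges 𝒳 𝒵 T) : ℤ) * ((if 4 ≤ #T then 1 else 0) + (if 5 ≤ #T then (#T : ℤ) - 2 else 0)) ≤
      ∑ E ∈ T.powersetCard 2, kap 𝒳 𝒵 ∅ (T \ E) := by
  have hnonneg : ∀ E ∈ T.powersetCard 2, 0 ≤ kap 𝒳 𝒵 ∅ (T \ E) := fun E _ => kap_nonneg h𝒳 h𝒵 _ _ (disjoint_empty_left _)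
  by_cases h4 : 4 ≤ #T
  swap
  · rw [if_neg h4, if_neg (by omega), add_zero, mul_zero]; exact sum_nonneg hnonneg
  rw [if_pos h4]
  by_cases h5 : 5 ≤ #T
  swap
  · -- t = 4: κ(∅, T \ E) = [T \ E common], summing to #W(T)
    rw [if_neg h5, add_zero, mul_one]
    have ht : #T = 4 := by omega
    have hterm : ∀ E ∈ T.powersetCard 2, kap 𝒳 𝒵 ∅ (T \ E) = if T \ E ∈ 𝒳 ∧ T \ E ∈ 𝒵 then 1 else 0 := fun E hE => by
      obtain ⟨hET, hE2⟩ := mem_powersetCard.1 hE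
      exact kap_empty_pair_eq hX2 hZ2 (by rw [card_sdiff_of_subset hET, ht, hE2])
    rw [sum_congr rfl hterm, ← Finset.sum_filter, sum_const, nsmul_eq_mul, mul_one]
    -- E ↦ T \ E is a bijection between the filtered 2-subsets and cedges
    apply le_of_eq; congr 1
    refine card_bij (fun e _ => T \ e) (fun e he => ?_) (fun e he e' he' h => ?_) (fun E hE => ?_)
    · obtain ⟨heT, he2, hX, hZ⟩ := mem_cedges.1 he
      refine mem_filter.2 ⟨mem_powersetCard.2 ⟨sdiff_subset, by rw [card_sdiff_of_subset heT, ht, he2]⟩, ?_⟩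
      rw [Finset.sdiff_sdiff_eq_self heT]; exact ⟨hX, hZ⟩
    · have h1 := (mem_cedges.1 he).1; have h2 := (mem_cedges.1 he').1
      rw [← Finset.sdiff_sdiff_eq_self h1, h, Finset.sdiff_sdiff_eq_self h2]
    · obtain ⟨hE, hX, hZ⟩ := mem_filter.1 hE
      obtain ⟨hET, hE2⟩ := mem_powersetCard.1 hE
      refine ⟨T \ E, mem_cedges.2 ⟨sdiff_subset, by rw [card_sdiff_of_subset hET, ht, hE2], hX, hZ⟩, Finset.sdiff_sdiff_eq_self hET⟩
  -- t ≥ 5: density lemma on each T \ E (size t−2 ≥ 3), then double counting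
  rw [if_pos h5]
  have hdens : ∀ E ∈ T.powersetCard 2,
      ((#T : ℤ) - 1) * #(cedges 𝒳 𝒵 (T \ E)) ≤ ((#T - 2).choose 2 : ℤ) * kap 𝒳 𝒵 ∅ (T \ E) := fun E hE => by
    obtain ⟨hET, hE2⟩ := mem_powersetCard.1 hE
    have hc : #(T \ E) = #T - 2 := by rw [card_sdiff_of_subset hET, hE2]
    have := density_le_kap h𝒳 h𝒵 hX2 hZ2 (#T - 2) (T \ E) hc (by omega)
    rw [hc] at this
    have e : ((#T - 2 : ℕ) : ℤ) + 1 = #T - 1 := by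
      have : 2 ≤ #T := by omega
      push_cast [Nat.cast_sub this]; ring
    rw [e] at this; exact this
  have hsum := sum_le_sum hdens
  rw [← mul_sum, ← mul_sum] at hsum
  have hdc : (∑ E ∈ T.powersetCard 2, (#(cedges 𝒳 𝒵 (T \ E)) : ℤ)) = ((#T - 2).choose 2 : ℤ) * #(cedges 𝒳 𝒵 T) := by
    exact_mod_cast sum_card_cedges_sdiff (𝒳 := 𝒳) (𝒵 := 𝒵) T
  rw [hdc] at hsum
  have hpos : (0 : ℤ) < ((#T - 2).choose 2 : ℤ) := by
    exact_mod_cast Nat.choose_pos (by omega)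
  -- cancel C(t−2, 2)
  have key : ((#T : ℤ) - 1) * #(cedges 𝒳 𝒵 T) ≤ ∑ E ∈ T.powersetCard 2, kap 𝒳 𝒵 ∅ (T \ E) := by
    have : ((#T - 2).choose 2 : ℤ) * (((#T : ℤ) - 1) * #(cedges 𝒳 𝒵 T)) ≤
        ((#T - 2).choose 2 : ℤ) * ∑ E ∈ T.powersetCard 2, kap 𝒳 𝒵 ∅ (T \ E) := by linarith
    exact le_of_mul_le_mul_left this hpos
  linarith

/-! ### Row (iii): three doubled points -/

/-- **Row (iii)**: for 2-live up-sets, `#D = 3` and `T` disjoint from `D`: `#W(D) ≤ Σ_{x ∈ D} κ({x}, (D − x) ∪ T)` — every common edge `yz ⊆ D`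
gives the based cubes at `y` and at `z` a common loop. [this work] -/
theorem row_three (h𝒳 : IsUpperSet (𝒳 : Set (Finset α))) (h𝒵 : IsUpperSet (𝒵 : Set (Finset α)))
    (hX2 : ∀ U ∈ 𝒳, 2 ≤ #U) (hZ2 : ∀ U ∈ 𝒵, 2 ≤ #U) {D T : Finset α} (hD : #D = 3) (hDT : Disjoint D T) :
    (#(cedges 𝒳 𝒵 D) : ℤ) ≤ ∑ x ∈ D, kap 𝒳 𝒵 {x} (D.erase x ∪ T) := by
  -- a vertex covered by a common edge inside D has κ ≥ 1
  have hcov : ∀ x ∈ D, (∃ y ∈ D.erase x, ({x, y} : Finset α) ∈ 𝒳 ∧ ({x, y} : Finset α) ∈ 𝒵) →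
      1 ≤ kap 𝒳 𝒵 {x} (D.erase x ∪ T) := fun x hx ⟨y, hy, hX, hZ⟩ => by
    have hvX : ({x} : Finset α) ∉ 𝒳 := fun h => by have := hX2 _ h; simp at this
    have hvZ : ({x} : Finset α) ∉ 𝒵 := fun h => by have := hZ2 _ h; simp at this
    rw [pair_comm] at hX hZ
    exact one_le_kap_of_loop h𝒳 h𝒵 hvX hvZ (mem_union_left _ hy) hX hZ
  have hnn : ∀ x ∈ D, 0 ≤ kap 𝒳 𝒵 {x} (D.erase x ∪ T) := fun x hx =>
    kap_nonneg h𝒳 h𝒵 _ _ (by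
      rw [disjoint_singleton_left, mem_union, not_or]
      exact ⟨notMem_erase x D, fun h => disjoint_left.1 hDT hx h⟩)
  -- covered vertices
  set C := D.filter fun x => ∃ y ∈ D.erase x, ({x, y} : Finset α) ∈ 𝒳 ∧ ({x, y} : Finset α) ∈ 𝒵 with hC
  have hsumC : (#C : ℤ) ≤ ∑ x ∈ D, kap 𝒳 𝒵 {x} (D.erase x ∪ T) := by
    have : ∑ x ∈ D, (if x ∈ C then (1 : ℤ) else 0) ≤ ∑ x ∈ D, kap 𝒳 𝒵 {x} (D.erase x ∪ T) :=
      sum_le_sum fun x hx => by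
        split_ifs with h
        · exact hcov x hx (mem_filter.1 h).2
        · exact hnn x hx
    rw [← Finset.sum_filter, filter_mem_eq_inter, inter_eq_right.2 (filter_subset _ D), sum_const, nsmul_eq_mul,
      mul_one] at this
    exact this
  refine le_trans ?_ hsumC
  -- #W(D) ≤ #covered: on three points, w edges cover ≥ w vertices
  by_cases hW : cedges 𝒳 𝒵 D = ∅
  · rw [hW, card_empty]; exact_mod_cast Nat.zero_le _
  obtain ⟨e, he⟩ := nonempty_iff_ne_empty.2 hW
  obtain ⟨heD, he2, hX, hZ⟩ := mem_cedges.1 he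
  obtain ⟨y, z, hyz, rfl⟩ := card_eq_two.1 he2
  have hy : y ∈ D := heD (by simp)
  have hz : z ∈ D := heD (by simp)
  -- both endpoints are covered
  have hyC : y ∈ C := mem_filter.2 ⟨hy, z, mem_erase.2 ⟨hyz.symm, hz⟩, hX, hZ⟩
  have hzC : z ∈ C := mem_filter.2 ⟨hz, y, mem_erase.2 ⟨hyz, hy⟩, by rw [pair_comm]; exact hX, by rw [pair_comm]; exact hZ⟩
  have h2C : 2 ≤ #C := by
    have : ({y, z} : Finset α) ⊆ C := insert_subset hyC (singleton_subset_iff.2 hzC)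
    have := card_le_card this; rw [card_pair hyz] at this; exact this
  have hWle3 : #(cedges 𝒳 𝒵 D) ≤ 3 := by
    have : cedges 𝒳 𝒵 D ⊆ D.powersetCard 2 := fun e he => by
      obtain ⟨h1, h2, _⟩ := mem_cedges.1 he; exact mem_powersetCard.2 ⟨h1, h2⟩
    have := card_le_card this; rw [card_powersetCard, hD] at this; exact this
  by_cases hW2 : #(cedges 𝒳 𝒵 D) ≤ 2
  · exact_mod_cast hW2.trans h2C
  · -- all three pairs are common: every vertex is covered
    have hW3 : cedges 𝒳 𝒵 D = D.powersetCard 2 := by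
      refine eq_of_subset_of_card_le (fun e he => ?_) (by rw [card_powersetCard, hD]; simp; omega)
      obtain ⟨h1, h2, _⟩ := mem_cedges.1 he; exact mem_powersetCard.2 ⟨h1, h2⟩
    have hall : C = D := by
      refine Subset.antisymm (filter_subset _ _) fun x hx => mem_filter.2 ⟨hx, ?_⟩
      -- pick any other point x' of D
      obtain ⟨x', hx'⟩ : (D.erase x).Nonempty := card_pos.1 (by rw [card_erase_of_mem hx, hD]; norm_num)
      have hmem : ({x, x'} : Finset α) ∈ cedges 𝒳 𝒵 D := by
        rw [hW3, mem_powersetCard]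
        exact ⟨insert_subset hx (singleton_subset_iff.2 (mem_of_mem_erase hx')), card_pair (ne_of_mem_erase hx').symm⟩
      obtain ⟨_, _, h1, h2⟩ := mem_cedges.1 hmem
      exact ⟨x', hx', h1, h2⟩
    rw [hall, hD]; exact_mod_cast hWle3

section Helpers
variable {d : α}

omit [DecidableEq α] in
/-- Counting helper: if every term is ≥ 0 and the terms outside `X` are ≥ 1 then the sum is at least `#S − #X`. [this work] -/
theorem card_sub_le_sum [DecidableEq α] {S X : Finset α} {f : α → ℤ} (h0 : ∀ y ∈ S, 0 ≤ f y)
    (h1 : ∀ y ∈ S, y ∉ X → 1 ≤ f y) : (#S : ℤ) - #X ≤ ∑ y ∈ S, f y := by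
  have hle : ∑ y ∈ S, (if y ∈ X then (0 : ℤ) else 1) ≤ ∑ y ∈ S, f y :=
    sum_le_sum fun y hy => by split_ifs with h; exact h0 y hy; exact h1 y hy h
  have heq : ∑ y ∈ S, (if y ∈ X then (0 : ℤ) else 1) = #(S.filter fun y => y ∉ X) := by
    rw [← sum_filter_add_sum_filter_not S (fun y => y ∈ X),
      sum_congr rfl fun y hy => if_pos (mem_filter.1 hy).2, sum_congr rfl fun y hy => if_neg (mem_filter.1 hy).2]
    simp
  have h := card_filter_add_card_filter_not (s := S) (fun y => y ∈ X)
  have h' : #(S.filter fun y => y ∈ X) ≤ #X := by rw [filter_mem_eq_inter]; exact card_le_card inter_subset_right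
  have e1 : (#S : ℤ) = #(S.filter fun y => y ∈ X) + #(S.filter fun y => ¬ y ∈ X) := by exact_mod_cast h.symm
  have e2 : (#(S.filter fun y => y ∈ X) : ℤ) ≤ #X := by exact_mod_cast h'
  linarith

/-- `y ∈ cnbrs 𝒳 𝒵 (insert d T) d ↔ y ∈ T ∧ {d,y} common` (for `d ∉ T`). [this work] -/
theorem mem_cnbrs_insert {T : Finset α} (hdT : d ∉ T) {y : α} :
    y ∈ cnbrs 𝒳 𝒵 (insert d T) d ↔ y ∈ T ∧ ({d, y} : Finset α) ∈ 𝒳 ∧ ({d, y} : Finset α) ∈ 𝒵 := by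
  unfold cnbrs; rw [erase_insert hdT, mem_filter]

/-- `cnbrs` after erasing a point of `T`. [this work] -/
theorem cnbrs_insert_erase {T : Finset α} (hdT : d ∉ T) (y₀ : α) :
    cnbrs 𝒳 𝒵 (insert d (T.erase y₀)) d = (cnbrs 𝒳 𝒵 (insert d T) d).erase y₀ := by
  unfold cnbrs
  rw [erase_insert hdT, erase_insert fun h => hdT (mem_of_mem_erase h), filter_erase]

/-- The common edges inside `T` through `y₀ ∈ T` correspond to the common neighbours of `y₀`:
`#W(T) = #W(T − y₀) + #cnbrs(T, y₀)`. [this work] -/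
theorem card_cedges_eq_erase_add {T : Finset α} {y₀ : α} (hy₀ : y₀ ∈ T) :
    #(cedges 𝒳 𝒵 T) = #(cedges 𝒳 𝒵 (T.erase y₀)) + #(cnbrs 𝒳 𝒵 T y₀) := by
  rw [cedges_erase, ← card_filter_add_card_filter_not (s := cedges 𝒳 𝒵 T) (fun e => y₀ ∉ e)]
  congr 1
  have : ((cedges 𝒳 𝒵 T).filter fun e => ¬ y₀ ∉ e) = (cnbrs 𝒳 𝒵 T y₀).image fun u => ({y₀, u} : Finset α) := by
    ext e
    simp only [mem_filter, not_not, mem_image, mem_cedges, mem_cnbrs]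
    constructor
    · rintro ⟨⟨heT, he2, hX, hZ⟩, hy⟩
      obtain ⟨a, b, hab, rfl⟩ := card_eq_two.1 he2
      simp only [mem_insert, mem_singleton] at hy
      rcases hy with rfl | rfl
      · exact ⟨b, ⟨⟨heT (by simp), hab.symm⟩, hX, hZ⟩, rfl⟩
      · refine ⟨a, ⟨⟨heT (by simp), hab⟩, ?_, ?_⟩, pair_comm _ _⟩ <;> rw [pair_comm] <;> assumption
    · rintro ⟨u, ⟨⟨huT, huy⟩, hX, hZ⟩, rfl⟩
      exact ⟨⟨insert_subset hy₀ (singleton_subset_iff.2 huT), card_pair huy.symm, hX, hZ⟩, by simp⟩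
  rw [this, card_image_of_injOn]
  intro u hu u' hu' h
  have hne : u ≠ y₀ := (mem_cnbrs.1 (Finset.mem_coe.1 hu)).1.2
  have h' : ({y₀, u} : Finset α) = {y₀, u'} := h
  have : u ∈ ({y₀, u'} : Finset α) := by rw [← h']; simp
  simp only [mem_insert, mem_singleton] at this
  rcases this with h1 | h1
  · exact absurd h1 hne
  · exact h1


end Helpers

end Summit.CriticalPhenomena.PercolationContinuityZ3.Theorems.SahiCTCForms
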